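import Literature.MathematicalPhysics.QuantumFieldTheory.Balaban1983to89.Node00.Record12NumericsFamily

/-!
# NODE 00 (YM-PLAN Track A) — STAGE 12, THE STAGE-1∕3 DICTIONARY OF THE FAMILY `stage3OfFamily F` (block size `L := F.L`, `ℓ₆ := F.L − 1`), THE MAKER
# WITH THE DICTIONARY AS AN ARGUMENT (`stage8OfNumericsD`, `stage12OfNumericsD`), AND THE WITNESS `θ₀ᶠᵃᵐ·ᴸ(ε₀) = theta12OfFamilyL F N ε₀ ζ Rz Zt` WHOSE
# BLOCK SIZE IS THE FAMILY'S — so N10's Lemma-3 level-T binder `8 ≤ θ.ℓ₆ + 1` and the (D4) Kotecký–Preiss numeral at `ℓ = ½L` are THEOREMS at the witness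

Cell `pub-ymgap`, seat `pub-ymgap-node00-def-K0a` (g3; rows G1 numerics ∕ D1 witness).  [I] = [Balaban1987RG1], [II] = [Balaban1988RG2Cluster],
[III] = [Balaban1988Convergent], [B6] = [Balaban1984PropagatorsII].  dag-n10-d g5 LOCATED-N10-ELL (one-declarer ask, taken by this seat).

WHY.  `Record12Numerics` fixed the Stage-1∕2∕3 dictionary of every K0′ witness AS A CLOSED TERM `stage3OfRecord₁₂` with block size `L := 3`, `ℓ₆ := 2`
(the `Stage1Params.exists_admissible` values) and hard-coded it in the maker `stage8OfNumerics`.  Print has ONE block size — the family's, `T4Family.L`, «an odd,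
positive integer > 11» ([I] (0.1) p. 251) — and two consumers at the record read the dictionary's letter: N10's Lemma 3 through the tree's printed scale transfer
(2.36) `ineq236Printed_torus (hL : 8 ≤ L)` ([II] p. 19), displayed at the record as the binder `hL8 : 8 ≤ θ.ℓ₆ + 1` — FALSE at `ℓ₆ = 2`, so N10's level-T road is
closed at every witness typed so far (LOCATED-N10-ELL) — and the (D4) wall's Kotecký–Preiss numeral `10·(64·log 162 + 1) ≤ (½(ℓ₆+1) − 1)·κ`, whose factor is `½`
at `L = 3` but `≥ 5.5` at print's `L ≥ 13`.  `Stage1Params.Admissible` reads NO block-size letter, so re-pinning the dictionary to the family costs nothing in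
admissibility.  This file (i) declares the dictionary OF THE FAMILY `stage3OfFamily F` (`L := F.L`, `hL := F.hL` — the same shape `Odd L ∧ 1 < L` —, `ℓ₆ := F.L − 1`,
`δ₀ := 2∕L`), (ii) re-issues the makers with the dictionary as an ARGUMENT (`stage8OfNumericsD`, `stage12OfNumericsD`; the landed makers ARE these at
`stage3OfRecord₁₂`, `rfl`), and (iii) builds the witness `theta12OfFamilyL F N ε₀ ζ Rz Zt` over `stage3OfFamily F` and the numerics of the family
(`stage12NumericsOfFamily ε₀`: κ := 2·10⁴, `ε₀` the open letter of row N2) — the Stage-12 term this seat's Stage-13 witness extends by `ε₁` and re-pins to the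
live selector once `Node00/Record13.lean` lands.

WHAT THIS FILE PROVIDES.
* §1 `stage3OfFamily F` + `rfl` views, `admissible_stage3OfFamily`, ★ `eight_le_L_stage3OfFamily`, `twelve_le_L_stage3OfFamily` (N10's binders `hL8`, `hN12` at
  `n = 0`, from `T4Family.hL11`).
* §2 `stage8OfNumericsD`, `stage12OfNumericsD` + `rfl` views, `stage8OfNumerics_eq_D` ∕ `stage12OfNumerics_eq_D`, `isChartOfRecord_stage8OfNumericsD`,
  `admissible_stage12OfNumericsD_iff : … ↔ d.Admissible ∧ n.Pos`, `admissible_stage12OfNumericsD`.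
* §3 `theta12OfFamilyL F N ε₀ ζ Rz Zt` + `rfl` views (`_L = F.L`, `_ℓ₆ = F.L − 1`, …), ★ `eight_le_L_theta12OfFamilyL`, `admissible_theta12OfFamilyL (hε : 0 < ε₀)`,
  `hasResidualsOfRecord_theta12OfFamilyL`, the three κ numerals `kp_tree_∕kp_n10_∕kp_large_theta12OfFamilyL` (the last at the family's block size via
  `kp_large_lfConstsOfFamily_of_three_le`).

## HONEST FRAMING — what this is NOT

* Dictionary letters READ FROM THE FAMILY plus displayed numerals; NOT Bałaban's undetermined constants; nothing of Bałaban's is asserted; no proviso is touched;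
  K0′ is NOT discharged; no node count moves (typed 28∕28 · discharged 5∕28).  `theta12OfRecord` ∕ `theta12OfFamily` (L = 3) stay as landed for rev-15 readers.
* One finite four-torus programme at fixed `ε = L^{−K}` — NOT the continuum limit on ℝ⁴, NOT infinite volume, NOT OS, NOT a mass gap, NOT the Clay problem.
  No `sorry`, no `axiom`, no `instance`, no `notation`.
-/

noncomputable section

open MeasureTheory
open scoped Matrix.Norms.L2Operator

namespace Literature.MathematicalPhysics.QuantumFieldTheory.Balaban1983to89.Node00

open T4Continuum AveragingRT T4FiniteEpsInhabited FlowStep FlowStepRuns DagBinding T4DatumAssembly B4GaugeCovariance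

/-! ## §1. The Stage-1∕3 dictionary OF THE FAMILY: block size `L := F.L` -/

/-- **THE STAGE-1∕2∕3 DICTIONARY OF THE FAMILY `F`**: the dictionary of record `stage3OfRecord₁₂` (two colours, rotation flow, `D = 4`, unit windows, `𝔸 := ℂ`,
`d₆ = 3`, weight band `1`) with Bałaban's block size READ FROM THE FAMILY — `L := F.L` (odd, `> 11`: `T4Family.hL`, `.hL11`), `ℓ₆ := F.L − 1` (`ℓ₆ + 1 = L`), and the
Lemma-2.1 rate at its ceiling `δ₀ := 2 ∕ L`. [cite: Balaban1987RG1, (0.1) p.251 («L is an odd, positive integer > 11»); Balaban1984PropagatorsII, (2.1)–(2.4) p.224, (2.16) p.225, (2.59) p.233; Balaban1983RegularityDecay, (1.2) p.572 (parameter dictionary; bookkeeping witness)] -/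
def stage3OfFamily (F : T4Family) : Stage3Params :=
  { stage3OfRecord₁₂ with
    L := F.L
    hL := F.hL
    ℓ₆ := F.L - 1
    hℓ₆ := Nat.sub_add_cancel F.hL.2.le
    δ₀ := 2 / (((F.L - 1 : ℕ) : ℝ) + 1)
    hδ₀ := ⟨by positivity, le_rfl⟩ }

variable (F : T4Family)

/-- The dictionary of the family has the family's block size (`rfl`). [cite: Balaban1987RG1, (0.1) p.251 (bookkeeping)] -/
theorem stage3OfFamily_L : (stage3OfFamily F).L = F.L := rfl

/-- … and block-size index `ℓ₆ = F.L − 1` (`rfl`). [cite: Balaban1984PropagatorsII, (2.1) p.224 (bookkeeping)] -/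
theorem stage3OfFamily_ℓ₆ : (stage3OfFamily F).ℓ₆ = F.L - 1 := rfl

/-- … so `ℓ₆ + 1 = F.L`. [cite: Balaban1984PropagatorsII, (2.1) p.224 (bookkeeping)] -/
theorem stage3OfFamily_ℓ₆_succ : (stage3OfFamily F).ℓ₆ + 1 = F.L := Nat.sub_add_cancel F.hL.2.le

/-- … physical dimension `D = 4` (`rfl`). [cite: Balaban1987RG1, p.253 (bookkeeping)] -/
theorem stage3OfFamily_D : (stage3OfFamily F).D = 4 := rfl

/-- … and Lemma-2.1 rate `δ₀ = 2 ∕ ((F.L − 1) + 1)` (`rfl`). [cite: Balaban1984PropagatorsII, (2.59) p.233 (bookkeeping)] -/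
theorem stage3OfFamily_δ₀ : (stage3OfFamily F).δ₀ = 2 / (((F.L - 1 : ℕ) : ℝ) + 1) := rfl

/-- **The dictionary of the family is Stage-1 admissible** (`Stage1Params.Admissible` reads no block-size letter: the numerals of `admissible_stage3OfRecord₁₂`).
[cite: Balaban1983RegularityDecay, (1.6) p.572 (bookkeeping)] -/
theorem admissible_stage3OfFamily : (stage3OfFamily F).toStage1Params.Admissible :=
  ⟨by norm_num [stage3OfFamily, stage3OfRecord₁₂], le_rfl, le_rfl, one_pos, one_pos, one_pos, le_rfl, le_rfl, le_rfl, one_pos, le_rfl, le_rfl, le_rfl⟩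

/-- **★ N10's LEMMA-3 LEVEL-T BINDER IS A THEOREM AT THE DICTIONARY OF THE FAMILY**: `8 ≤ ℓ₆ + 1` (print's «L > 11»; the tree's printed scale transfer (2.36)
`ineq236Printed_torus` wants `8 ≤ L`). [cite: Balaban1987RG1, (0.1) p.251; Balaban1988RG2Cluster, (2.36) p.19] -/
theorem eight_le_L_stage3OfFamily : 8 ≤ (stage3OfFamily F).ℓ₆ + 1 := by
  rw [stage3OfFamily_ℓ₆_succ]
  have := F.hL11
  omega

/-- … and `12 ≤ ℓ₆ + 1` (N10's `hN12` at `n = 0`). [cite: Balaban1987RG1, (0.1) p.251 (bookkeeping)] -/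
theorem twelve_le_L_stage3OfFamily : 12 ≤ (stage3OfFamily F).ℓ₆ + 1 := by
  rw [stage3OfFamily_ℓ₆_succ]
  have := F.hL11
  omega

/-! ## §2. The makers WITH THE DICTIONARY AS AN ARGUMENT -/

section MakerD

variable (N : ℕ) [NeZero N]

/-- **Stage-8 parameters FROM A DICTIONARY `d`, NUMERICS `n` and a Stage-5 residual `res`** — `Record12Numerics.stage8OfNumerics` with the Stage-1∕3 dictionary as an
argument instead of the closed `stage3OfRecord₁₂`: window `γ := n.γ`, `res`, `ν := n.ν`, def-R's trivial representation, `Efl = logz := 0`, `εbg := n.εbg`, the chart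
of record of 𝔰𝔲(N) (`c = 1`), base histories `v₀ := 0`. [cite: Balaban1987RG1, (0.21) p.256 and (1.20)–(1.22) p.264; Balaban1988Convergent, (2.4)–(2.5) p.255; Balaban1989LargeFieldI, (0.2) p.176 (parameter dictionary)] -/
def stage8OfNumericsD (d : Stage3Params) (n : Stage12Numerics) (res : Residual₅ F N) : Stage8Params F N :=
  { d with
    γ := n.γ
    res := res
    ν := n.ν
    rep := trivialRepOfRecord F N
    Efl := fun _ _ => 0
    logz := fun _ _ => 0
    εbg := n.εbg
    Vβ := Fin (suChartDim N) → ℝ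
    ιβ := Fin (suChartDim N)
    ρ8 := suChartMap N
    bV := Pi.basisFun ℝ (Fin (suChartDim N))
    v₀ := fun _ _ => 0 }

/-- **Stage-12 parameters FROM A DICTIONARY, NUMERICS, a Stage-5 residual and the residual objects `ζ`, `Rz`, `Zt`** — `Record12Numerics.stage12OfNumerics` with the
dictionary as an argument: over `stage8OfNumericsD d n res`, `τ9 := n.τ9`, the identity `p–p′` selector, `A₁ := n.A₁`, `ζ`, `ScorrLaw := ⊤`, `cβ := 1`, `s2 := n.s2`,
`Rz`, `Zt`. [cite: Balaban1988Convergent, (2.21) p.258, (3.4) p.265, (3.16) p.268, (3.21) p.269; Balaban1989LargeFieldI, (0.3) p.176, (2.1) p.182; Balaban1987RG1, (1.15) p.262 (parameter dictionary)] -/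
def stage12OfNumericsD (d : Stage3Params) (n : Stage12Numerics) (res : Residual₅ F N) (ζ : ZetaOfRecord F N n.ν n.τ9.M)
    (Rz : (K : ℕ) → Sect2.Residual (F.P K) (MatA N)) (Zt : (K : ℕ) → TkResidualW F N (FluctV N) K) : Stage12Params F N :=
  { stage8OfNumericsD F N d n res with
    τ9 := n.τ9
    ppSel := ppSelIdOfRecord F n.ν n.τ9.M
    A₁ := n.A₁
    ζ := ζ
    ScorrLaw := fun _ _ _ => True
    cβ := 1
    s2 := n.s2
    Rz := Rz
    Zt := Zt }

/-- **The landed Stage-8 maker IS the D-maker at the dictionary of record** (`rfl`). [cite: Balaban1987RG1, (0.21) p.256 (bookkeeping)] -/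
theorem stage8OfNumerics_eq_D (n : Stage12Numerics) (res : Residual₅ F N) :
    stage8OfNumerics F N n res = stage8OfNumericsD F N stage3OfRecord₁₂ n res := rfl

variable (d : Stage3Params) (n : Stage12Numerics) (res : Residual₅ F N) (ζ : ZetaOfRecord F N n.ν n.τ9.M)
  (Rz : (K : ℕ) → Sect2.Residual (F.P K) (MatA N)) (Zt : (K : ℕ) → TkResidualW F N (FluctV N) K)

/-- **The landed Stage-12 maker IS the D-maker at the dictionary of record** (`rfl`) — so `theta12OfRecord`, `theta12OfFamily` are D-made at `stage3OfRecord₁₂`.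
[cite: Balaban1988Convergent, (2.10) p.256 (bookkeeping)] -/
theorem stage12OfNumerics_eq_D : stage12OfNumerics F N n res ζ Rz Zt = stage12OfNumericsD F N stage3OfRecord₁₂ n res ζ Rz Zt := rfl

/-- The D-maker's dictionary IS `d` (`rfl`, structure eta). [cite: Balaban1984PropagatorsII, (2.1) p.224 (bookkeeping)] -/
theorem stage12OfNumericsD_toStage3Params : (stage12OfNumericsD F N d n res ζ Rz Zt).toStage3Params = d := rfl

/-- The D-maker's block-size index IS `d.ℓ₆` (`rfl`). [cite: Balaban1984PropagatorsII, (2.1) p.224 (bookkeeping)] -/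
theorem stage12OfNumericsD_ℓ₆ : (stage12OfNumericsD F N d n res ζ Rz Zt).ℓ₆ = d.ℓ₆ := rfl

/-- The D-maker's Stage-8 part (`rfl`). [cite: Balaban1987RG1, (0.21) p.256 (bookkeeping)] -/
theorem stage12OfNumericsD_toStage8Params : (stage12OfNumericsD F N d n res ζ Rz Zt).toStage8Params = stage8OfNumericsD F N d n res := rfl

/-- The D-maker's Stage-7 numerics ARE `n.ν` (`rfl`). [cite: Balaban1988Convergent, (2.4) p.255 (bookkeeping)] -/
theorem stage12OfNumericsD_ν : (stage12OfNumericsD F N d n res ζ Rz Zt).ν = n.ν := rfl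

/-- The D-maker's window constant IS `n.γ` (`rfl`). [cite: Balaban1987RG1, Thm 1 p.255 (bookkeeping)] -/
theorem stage12OfNumericsD_γ : (stage12OfNumericsD F N d n res ζ Rz Zt).γ = n.γ := rfl

/-- The D-maker's tower numerics ARE `n.τ9` (`rfl`). [cite: Balaban1989LargeFieldI, (2.1) p.182 (bookkeeping)] -/
theorem stage12OfNumericsD_τ9 : (stage12OfNumericsD F N d n res ζ Rz Zt).τ9 = n.τ9 := rfl

/-- The D-maker's `A₁` IS `n.A₁` (`rfl`). [cite: Balaban1987RG1, (1.16) p.262 (bookkeeping)] -/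
theorem stage12OfNumericsD_A₁ : (stage12OfNumericsD F N d n res ζ Rz Zt).A₁ = n.A₁ := rfl

/-- The D-maker's §2 numerics ARE `n.s2` (`rfl`). [cite: Balaban1988Convergent, (2.34)–(2.39) p.261 (bookkeeping)] -/
theorem stage12OfNumericsD_s2 : (stage12OfNumericsD F N d n res ζ Rz Zt).s2 = n.s2 := rfl

/-- The D-maker keeps `ζ` (`rfl`). [cite: Balaban1988Convergent, (3.16) p.268 (bookkeeping)] -/
theorem stage12OfNumericsD_ζ : (stage12OfNumericsD F N d n res ζ Rz Zt).ζ = ζ := rfl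

/-- The D-maker keeps `Rz` (`rfl`). [cite: Balaban1988Convergent, (2.21) p.258 (bookkeeping)] -/
theorem stage12OfNumericsD_Rz : (stage12OfNumericsD F N d n res ζ Rz Zt).Rz = Rz := rfl

/-- The D-maker keeps `Zt` (`rfl`). [cite: Balaban1988Convergent, (3.20) p.269 (bookkeeping)] -/
theorem stage12OfNumericsD_Zt : (stage12OfNumericsD F N d n res ζ Rz Zt).Zt = Zt := rfl

/-- The D-maker's selector is the identity selector (`rfl`). [cite: Balaban1989LargeFieldI, (0.3) p.176 (bookkeeping)] -/
theorem stage12OfNumericsD_ppSel : (stage12OfNumericsD F N d n res ζ Rz Zt).ppSel = ppSelIdOfRecord F n.ν n.τ9.M := rfl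

/-- **The D-maker's chart IS a chart of record with `c = 1`** (`isSuChart_suChartMap`). [cite: Balaban1987RG1, (1.20)–(1.21) p.264] -/
theorem isChartOfRecord_stage8OfNumericsD : (stage8OfNumericsD F N d n res).IsChartOfRecord 1 :=
  isSuChart_suChartMap N

/-- **STAGE-12 ADMISSIBILITY OF THE D-MAKER ↔ the dictionary is Stage-1 admissible ∧ `n.Pos`** — residual-blind (as `admissible_stage12OfNumerics_iff`, with the
dictionary's admissibility displayed instead of `admissible_stage3OfRecord₁₂`). [cite: Balaban1987RG1, (0.21) p.256, (1.12) p.262, (1.20)–(1.21) p.264; Balaban1988Convergent, (2.4) p.255, (2.10) p.256, (2.28) p.259, (2.34)–(2.39) p.261, (3.4) p.265; Balaban1989LargeFieldI, (2.1) p.182 (hypothesis dictionary; bookkeeping)] -/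
theorem admissible_stage12OfNumericsD_iff :
    (stage12OfNumericsD F N d n res ζ Rz Zt).Admissible F N ↔ d.toStage1Params.Admissible ∧ n.Pos := by
  constructor
  · rintro ⟨⟨⟨⟨⟨hd, hγ⟩, hν⟩, hε⟩, -, -, hM⟩, hs2, hcR, hA₁, hC₀, hC₁, hγ1⟩
    exact ⟨hd, hν, hε, ⟨hγ, hγ1⟩, hM, hA₁, hs2, hcR, hC₀, hC₁⟩
  · rintro ⟨hd, hν, hε, ⟨hγ, hγ1⟩, hM, hA₁, hs2, hcR, hC₀, hC₁⟩
    exact ⟨⟨⟨⟨⟨hd, hγ⟩, hν⟩, hε⟩, one_pos, isChartOfRecord_stage8OfNumericsD F N d n res, hM⟩, hs2, hcR, hA₁, hC₀, hC₁, hγ1⟩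

/-- The D-maker is admissible at an admissible dictionary and positive numerics. [cite: Balaban1988Convergent, (2.10) p.256, (2.28) p.259, (2.34)–(2.39) p.261 (bookkeeping)] -/
theorem admissible_stage12OfNumericsD (hd : d.toStage1Params.Admissible) (hn : n.Pos) : (stage12OfNumericsD F N d n res ζ Rz Zt).Admissible F N :=
  (admissible_stage12OfNumericsD_iff F N d n res ζ Rz Zt).mpr ⟨hd, hn⟩

end MakerD

/-- **Row N1's (D4) `large` numeral AT ANY BLOCK SIZE `L ≥ 3`** (Kotecký–Preiss form at `ℓ = ½L`): `10·(64·log 162 + 1) ≤ (L∕2 − 1)·κ` at `κ = 2·10⁴` — at print's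
`L ≥ 13` the factor is `≥ 5.5`, at the dictionary of record's `L = 3` it is `½`. [cite: Balaban1987RG1, (0.25)–(0.26) p.257; Balaban1988RG2Cluster, p.21 (after (2.39))] -/
theorem kp_large_lfConstsOfFamily_of_three_le {L : ℕ} (hL : 3 ≤ L) : 10 * (64 * Real.log 162 + 1) ≤ (((L : ℕ) : ℝ) / 2 - 1) * lfConstsOfFamily.κ := by
  rw [lfConstsOfFamily_κ]
  have hL' : (3 : ℝ) ≤ L := by exact_mod_cast hL
  nlinarith [log_162_lt_six]

/-! ## §3. The witness WITH THE FAMILY'S BLOCK SIZE `θ₀ᶠᵃᵐ·ᴸ(ε₀) = theta12OfFamilyL F N ε₀ ζ Rz Zt` -/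

section ThetaL

variable (F : T4Family) (N : ℕ) [NeZero N] (ε₀ : ℝ)
variable (ζ : ZetaOfRecord F N (numerics7OfFamily ε₀) 1) (Rz : (K : ℕ) → Sect2.Residual (F.P K) (MatA N)) (Zt : (K : ℕ) → TkResidualW F N (FluctV N) K)

/-- **THE STAGE-12 WITNESS OF THE FAMILY WITH THE FAMILY'S BLOCK SIZE** `θ₀ᶠᵃᵐ·ᴸ(ε₀)`: the D-maker at the dictionary OF THE FAMILY `stage3OfFamily F` (`L := F.L`), the
numerics of the family `stage12NumericsOfFamily ε₀` (κ := 2·10⁴; `ε₀` the open letter of row N2), the degenerate Stage-5 residual, the identity selector, and the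
residual objects `ζ`, `Rz`, `Zt` as ARGUMENTS.  The Stage-12 term this seat's Stage-13 witness extends by `ε₁` and re-pins to the live selector.
[cite: Balaban1987RG1, (0.1) p.251, (0.21) p.256, (1.12)–(1.16) p.262, (1.18) p.263; Balaban1988Convergent, (2.4) p.255, (2.10) p.256, (2.21) p.258, (2.28) p.259, (3.4) p.265, (3.16) p.268; Balaban1989LargeFieldI, (0.3) p.176, (2.1) p.182 (parameter dictionary; bookkeeping witness)] -/
def theta12OfFamilyL : Stage12Params F N :=
  stage12OfNumericsD F N (stage3OfFamily F) (stage12NumericsOfFamily ε₀) (residual5OfRecord₁₂ F N) ζ Rz Zt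

/-- `θ₀ᶠᵃᵐ·ᴸ(ε₀).L = F.L` (`rfl`). [cite: Balaban1987RG1, (0.1) p.251 (bookkeeping)] -/
theorem theta12OfFamilyL_L : (theta12OfFamilyL F N ε₀ ζ Rz Zt).L = F.L := rfl

/-- `θ₀ᶠᵃᵐ·ᴸ(ε₀).ℓ₆ = F.L − 1` (`rfl`). [cite: Balaban1984PropagatorsII, (2.1) p.224 (bookkeeping)] -/
theorem theta12OfFamilyL_ℓ₆ : (theta12OfFamilyL F N ε₀ ζ Rz Zt).ℓ₆ = F.L - 1 := rfl

/-- `θ₀ᶠᵃᵐ·ᴸ(ε₀).ℓ₆ + 1 = F.L`. [cite: Balaban1984PropagatorsII, (2.1) p.224 (bookkeeping)] -/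
theorem theta12OfFamilyL_ℓ₆_succ : (theta12OfFamilyL F N ε₀ ζ Rz Zt).ℓ₆ + 1 = F.L := stage3OfFamily_ℓ₆_succ F

/-- **★ N10's LEMMA-3 LEVEL-T BINDER HOLDS AT `θ₀ᶠᵃᵐ·ᴸ(ε₀)`**: `8 ≤ θ.ℓ₆ + 1`. [cite: Balaban1987RG1, (0.1) p.251; Balaban1988RG2Cluster, (2.36) p.19] -/
theorem eight_le_L_theta12OfFamilyL : 8 ≤ (theta12OfFamilyL F N ε₀ ζ Rz Zt).ℓ₆ + 1 := eight_le_L_stage3OfFamily F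

/-- … and `12 ≤ θ.ℓ₆ + 1` (N10's `hN12` at `n = 0`). [cite: Balaban1987RG1, (0.1) p.251 (bookkeeping)] -/
theorem twelve_le_L_theta12OfFamilyL : 12 ≤ (theta12OfFamilyL F N ε₀ ζ Rz Zt).ℓ₆ + 1 := twelve_le_L_stage3OfFamily F

/-- `θ₀ᶠᵃᵐ·ᴸ(ε₀).ν = numerics7OfFamily ε₀` (`rfl`). [cite: Balaban1988Convergent, (2.4) p.255 (bookkeeping)] -/
theorem theta12OfFamilyL_ν : (theta12OfFamilyL F N ε₀ ζ Rz Zt).ν = numerics7OfFamily ε₀ := rfl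

/-- `θ₀ᶠᵃᵐ·ᴸ(ε₀).γ = 1∕2` (`rfl`). [cite: Balaban1987RG1, Thm 1 p.255 (bookkeeping)] -/
theorem theta12OfFamilyL_γ : (theta12OfFamilyL F N ε₀ ζ Rz Zt).γ = 1 / 2 := rfl

/-- `θ₀ᶠᵃᵐ·ᴸ(ε₀).A₁ = 1` (`rfl`). [cite: Balaban1987RG1, (1.16) p.262 (bookkeeping)] -/
theorem theta12OfFamilyL_A₁ : (theta12OfFamilyL F N ε₀ ζ Rz Zt).A₁ = 1 := rfl

/-- `θ₀ᶠᵃᵐ·ᴸ(ε₀).τ9.M = 1` (`rfl`). [cite: Balaban1989LargeFieldI, (2.1) p.182 (bookkeeping)] -/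
theorem theta12OfFamilyL_τ9_M : (theta12OfFamilyL F N ε₀ ζ Rz Zt).τ9.M = 1 := rfl

/-- `θ₀ᶠᵃᵐ·ᴸ(ε₀).s2 = sect2NumericsOfFamily` (`rfl`). [cite: Balaban1988Convergent, (2.34)–(2.39) p.261 (bookkeeping)] -/
theorem theta12OfFamilyL_s2 : (theta12OfFamilyL F N ε₀ ζ Rz Zt).s2 = sect2NumericsOfFamily := rfl

/-- `θ₀ᶠᵃᵐ·ᴸ(ε₀).s2.lf.κ = 2·10⁴` (`rfl`). [cite: Balaban1987RG1, (1.18) p.263 (bookkeeping)] -/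
theorem theta12OfFamilyL_κ : (theta12OfFamilyL F N ε₀ ζ Rz Zt).s2.lf.κ = 20000 := rfl

/-- `θ₀ᶠᵃᵐ·ᴸ(ε₀)` keeps `ζ` (`rfl`). [cite: Balaban1988Convergent, (3.16) p.268 (bookkeeping)] -/
theorem theta12OfFamilyL_ζ : (theta12OfFamilyL F N ε₀ ζ Rz Zt).ζ = ζ := rfl

/-- `θ₀ᶠᵃᵐ·ᴸ(ε₀)` keeps `Rz` (`rfl`). [cite: Balaban1988Convergent, (2.21) p.258 (bookkeeping)] -/
theorem theta12OfFamilyL_Rz : (theta12OfFamilyL F N ε₀ ζ Rz Zt).Rz = Rz := rfl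

/-- `θ₀ᶠᵃᵐ·ᴸ(ε₀)` keeps `Zt` (`rfl`). [cite: Balaban1988Convergent, (3.20) p.269 (bookkeeping)] -/
theorem theta12OfFamilyL_Zt : (theta12OfFamilyL F N ε₀ ζ Rz Zt).Zt = Zt := rfl

/-- `θ₀ᶠᵃᵐ·ᴸ(ε₀)`'s selector is the identity selector (`rfl`). [cite: Balaban1989LargeFieldI, (0.3) p.176 (bookkeeping)] -/
theorem theta12OfFamilyL_ppSel : (theta12OfFamilyL F N ε₀ ζ Rz Zt).ppSel = ppSelIdOfRecord F (numerics7OfFamily ε₀) 1 := rfl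

variable {ε₀} in
/-- **`θ₀ᶠᵃᵐ·ᴸ(ε₀)` IS ADMISSIBLE at every positive threshold** — every family, every `N ≥ 1`, every choice of the residual objects.
[cite: Balaban1987RG1, (0.21) p.256, (1.12) p.262, (1.20)–(1.21) p.264; Balaban1988Convergent, (2.10) p.256, (2.28) p.259, (2.34)–(2.39) p.261, (3.4) p.265 (bookkeeping witness)] -/
theorem admissible_theta12OfFamilyL (hε : 0 < ε₀) : (theta12OfFamilyL F N ε₀ ζ Rz Zt).Admissible F N :=
  admissible_stage12OfNumericsD F N (stage3OfFamily F) (stage12NumericsOfFamily ε₀) (residual5OfRecord₁₂ F N) ζ Rz Zt (admissible_stage3OfFamily F)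
    (stage12NumericsOfFamily_pos hε)

/-- **AT K0b's RESIDUALS OF RECORD `θ₀ᶠᵃᵐ·ᴸ(ε₀)` CARRIES THEM** (`⟨rfl, rfl, rfl⟩`). [cite: Balaban1988Convergent, (3.16) p.268, (2.21) p.258, (3.20) p.269 (bookkeeping)] -/
theorem hasResidualsOfRecord_theta12OfFamilyL :
    (theta12OfFamilyL F N ε₀ (zeta316OfRecord F N (numerics7OfFamily ε₀) 1 1) (RzOfRecord F N) (ZtOfRecord F N)).HasResidualsOfRecord F N :=
  ⟨rfl, rfl, rfl⟩

/-- Row N1 AT `θ₀ᶠᵃᵐ·ᴸ(ε₀)`: the (D4) `tree` numeral `128·log 162 ≤ κ`. [cite: Balaban1987RG1, (0.25)–(0.26) p.257; Balaban1988RG2Cluster, (1.26) p.8] -/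
theorem kp_tree_theta12OfFamilyL : 128 * Real.log 162 ≤ (theta12OfFamilyL F N ε₀ ζ Rz Zt).s2.lf.κ :=
  kp_tree_lfConstsOfFamily

/-- Row N1 AT `θ₀ᶠᵃᵐ·ᴸ(ε₀)`: N10's rate threshold `2·10⁴ ≤ κ`. [cite: Balaban1987RG1, (1.18) p.263 (bookkeeping numeral)] -/
theorem kp_n10_theta12OfFamilyL : (2 * 10 ^ 4 : ℝ) ≤ (theta12OfFamilyL F N ε₀ ζ Rz Zt).s2.lf.κ :=
  kp_n10_lfConstsOfFamily

/-- **★ Row N1 AT `θ₀ᶠᵃᵐ·ᴸ(ε₀)`: the (D4) `large` numeral AT THE FAMILY'S BLOCK SIZE** — `10·(64·log 162 + 1) ≤ (½(θ.ℓ₆+1) − 1)·θ.s2.lf.κ` with `θ.ℓ₆ + 1 = F.L ≥ 13`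
(the right-hand side of `condsL_large_c13OfRecord₁₂_half_iff`). [cite: Balaban1987RG1, (0.25)–(0.26) p.257; Balaban1988RG2Cluster, p.21 (after (2.39))] -/
theorem kp_large_theta12OfFamilyL :
    10 * (64 * Real.log 162 + 1) ≤
      (((((theta12OfFamilyL F N ε₀ ζ Rz Zt).ℓ₆ + 1 : ℕ) : ℝ)) / 2 - 1) * (theta12OfFamilyL F N ε₀ ζ Rz Zt).s2.lf.κ := by
  rw [theta12OfFamilyL_ℓ₆_succ, theta12OfFamilyL_s2, sect2NumericsOfFamily_lf]
  have h3 : 3 ≤ F.L := by have := F.hL11; omega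
  exact kp_large_lfConstsOfFamily_of_three_le h3

end ThetaL

end Literature.MathematicalPhysics.QuantumFieldTheory.Balaban1983to89.Node00

end
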